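import Summits.AtomisticToContinuum.Crystallization.Theses.ReggeStarCoercivity
import Summits.AtomisticToContinuum.Crystallization.Theses.PalmUnimodularRigidity
import Summits.AtomisticToContinuum.Crystallization.Theorems.DefectFreeCrystallizes.Negative.PredicateAPI
import Summits.AtomisticToContinuum.Crystallization.Theorems.ReggeStarCoercivityDefectFreeCrystallizesPalmDefs
import Summits.AtomisticToContinuum.Crystallization.Theorems.ReggeStarCoercivityDefectFreeCrystallizesGoodLaw
import Summits.AtomisticToContinuum.Crystallization.Theorems.ReggeStarCoercivityDefectFreeCrystallizesFunnelChart
import Summits.AtomisticToContinuum.Crystallization.Theorems.ReggeStarCoercivityDefectFreeCrystallizesChargeFromFunnelLaw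
import Summits.AtomisticToContinuum.Crystallization.Theorems.ReggeStarCoercivityDefectFreeCrystallizesRouteBetaFloor
import Summits.AtomisticToContinuum.Crystallization.Theorems.ReggeStarCoercivityDefectFreeCrystallizesDefectVersion
import Summits.AtomisticToContinuum.Crystallization.Theorems.ReggeStarCoercivityDefectFreeCrystallizesAnnulusCount
import Summits.AtomisticToContinuum.Crystallization.Theorems.PalmUnimodularRigidityChargedPatternCrystallizes
import Summits.AtomisticToContinuum.Crystallization.Theorems.PalmUnimodularRigidityLayeredLawsSelectHcpDefs
import Summits.AtomisticToContinuum.Crystallization.Theorems.PalmUnimodularRigidityLayeredLawsSelectHcpRelaxedReference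
import Summits.AtomisticToContinuum.Crystallization.Theorems.PalmUnimodularRigidityCruxesToPalmRigidity
import Summits.AtomisticToContinuum.Crystallization.Theorems.ExcessDecayLiouvilleCoarseGrainsHcpEnergySeries
import Literature.Probability.Process.PointStationaryLaw
import Literature.MathematicalPhysics.StatisticalMechanics.BarlowStacking
import Literature.MathematicalPhysics.StatisticalMechanics.LennardJonesClusters
import Literature.Geometry.DiscreteGeometry.KissingPatterns
import Summits.AtomisticToContinuum.Crystallization.Theorems.ReggeStarCoercivityDefectFreeCrystallizesExactFrameH
import Summits.AtomisticToContinuum.Crystallization.Theorems.ReggeStarCoercivityDefectFreeCrystallizesExactFrameC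
import Summits.AtomisticToContinuum.Crystallization.Theorems.ReggeStarCoercivityDefectFreeCrystallizesFramePropagation
import Summits.AtomisticToContinuum.Crystallization.Theorems.ReggeStarCoercivityDefectFreeCrystallizesExactSelectionLawB
import Summits.AtomisticToContinuum.Crystallization.Theorems.MinMeanCycleStackingLockBarlowEnergyIdentification

/-!
# The exact-star shortcut, I: X2 `stub_exactStarRigidity` (exact stars everywhere ⇒ an exact stacking) from the landed X2a/X2b/X2c
(line `palm-good-law`, lead c9; strategist gen 2 `Lines/exact_star_shortcut.lean`; item stmt-AtomisticToContinuum-13603)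

The law-level CORE of the line (`stub_funnelDefectFloor`, robust funnel floor, the hypothesis `hCORE` below — verbatim the
registered stub) is written with EXACT reference stars, so on the crux's good limit law (`E_P[h] ≤ e* ≤ hcpE a₀ h₀`) it yields
`E_P[Dm] = 0`: almost surely EVERY star is exact (`ae_exactRoot_of_core` + Aldous–Lyons).  The remaining geometry and selection are
LANDED: X2a `ExactFrameH.stub_exactFrameH` (p156194), X2b `ExactFrameC.stub_exactFrameC` (p158272), X2c
`FramePropagation.stub_framePropagation` (p159157) — assembled here into X2 `stub_exactStarRigidity` (exact stars everywhere on a charted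
set ⇒ an exact rotated Barlow stacking; glue = re-rooting the chart by a WORD SHIFT, `barlowPos_add_shift`) — and X3
`ExactSelectionLawB.stub_exactSelectionLawB` (p161691; selection at exact geometry over the landed LJ column).  Hence
`defectFreeCrystallizes_of_funnelDefectFloor : CORE → DefectFreeCrystallizes` WITHOUT crux 9226 (compare
`RouteBetaDefectFloor.defectFreeCrystallizes_of_funnelDefectFloor : CORE → LayeredLawsSelectHcp → DefectFreeCrystallizes`, p150082).
All `[folklore]`.
-/

noncomputable section

open scoped BigOperators ENNReal
open Filter Topology MeasureTheory

namespace Summit.AtomisticToContinuum.Crystallization.Theorems.PalmGoodLaw.ExactStarShortcutRigidity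

open Summit.AtomisticToContinuum.Crystallization.Theses
open Summit.AtomisticToContinuum.Crystallization.Theses.ReggeStarCoercivity
open Summit.AtomisticToContinuum.Crystallization.Theorems.DefectFreeCrystallizes.Negative.PredicateAPI
open Literature.MathematicalPhysics.StatisticalMechanics Literature.Geometry.DiscreteGeometry
open Literature.Probability.Process
open Summit.AtomisticToContinuum.Crystallization.Theorems.PalmGoodLaw (SetGood)



/-! ### Glue X2 ⇐ X2a + X2b + X2c (lead c9; no sorry): re-rooting the chart at the label of `0` and bookkeeping -/

section ExactStarGlue

open Summit.AtomisticToContinuum.Crystallization.Theorems.PalmUnimodularRigidity.LayeredLawsSelectHcp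
  (hcpE hcpQ hcpSite hcpStarIdx rootStar starDefect starDefect_nonneg stub_relaxedReference)
open Summit.AtomisticToContinuum.Crystallization.Theorems.PalmUnimodularRigidity
  (ae_forall_map_sub_of_ae count_restrict_floorNorm_preimage_lt_top)

/-- Labels along a re-rooted Hägg word, additive form: `L_s(m + m₀) = L_s(m₀) + L_{s(·+m₀)}(m)` (the subtractive form is
`PrestressSplitKorn.haggLabel_shift`, whose module cannot be imported next to `MuGSC`). [folklore] -/
theorem haggLabel_add_eq (s : ℤ → ℤ) (m₀ m : ℤ) :
    haggLabel s (m + m₀) = haggLabel s m₀ + haggLabel (fun k => s (k + m₀)) m := by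
  induction m using Int.induction_on with
  | zero => simp
  | succ n ih =>
    rw [show (n : ℤ) + 1 + m₀ = (n + m₀) + 1 by ring, haggLabel_succ, ih, haggLabel_succ]
    ring
  | pred n ih =>
    have h1 := haggLabel_succ (fun k => s (k + m₀)) (-(n : ℤ) - 1)
    have h2 := haggLabel_succ s (-(n : ℤ) - 1 + m₀)
    rw [show -(n : ℤ) - 1 + 1 = -n by ring] at h1
    rw [show -(n : ℤ) - 1 + m₀ + 1 = -n + m₀ by ring] at h2
    linarith

/-- **Re-rooting a Barlow stacking at one of its sites shifts the word** (no rotation): the site `(k + k₀, i + i₀, j + j₀)` of the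
word `s` is the site `(k₀, i₀, j₀)` plus the site `(k, i, j)` of the shifted word `s (· + k₀)`, for all spacings. [folklore] -/
theorem barlowPos_add_shift (a h : ℝ) (s : ℤ → ℤ) (k₀ i₀ j₀ k i j : ℤ) :
    barlowPos a h s (k + k₀) (i + i₀) (j + j₀) =
      barlowPos a h s k₀ i₀ j₀ + barlowPos a h (fun m => s (m + k₀)) k i j := by
  ext l
  fin_cases l
  · simp only [Fin.zero_eta, Fin.isValue, PiLp.add_apply, barlowPos_apply_zero, haggLabel_add_eq]
    push_cast; ring
  · simp only [Fin.mk_one, Fin.isValue, PiLp.add_apply, barlowPos_apply_one, haggLabel_add_eq]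
    push_cast; ring
  · simp only [Fin.reduceFinMk, Fin.isValue, PiLp.add_apply, barlowPos_apply_two]
    push_cast; ring

/-- **X2 ⇐ X2a + X2b + X2c (sorry-free glue, lead c9).**  From the chart `Φ` of `S ∋ 0`, re-root the ideal stacking at the label
`(k₀, i₀, j₀)` of `0` (`barlowPos_add_shift`: the word is shifted, nothing rotates), index `S` by `X u = Φ(site (u + u₀))`
(injective, onto, `X 0 = 0`, charted for the shifted word), read the local frames from X2a/X2b and propagate them with X2c. [folklore] -/
theorem exactStarRigidity_of_frames
    (hH : ∀ a₀ h₀ : ℝ, 189 / 200 ≤ a₀ → a₀ ≤ 199 / 200 → 77 / 100 ≤ h₀ → h₀ ≤ 163 / 200 →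
      ∀ s : ℤ → ℤ, IsHaggSeq s →
      ∀ X : ℤ × ℤ × ℤ → EuclideanSpace ℝ (Fin 3), Function.Injective X →
        (∀ u w : ℤ × ℤ × ℤ,
          dist (barlowPos 1 (Real.sqrt (2 / 3)) s u.1 u.2.1 u.2.2) (barlowPos 1 (Real.sqrt (2 / 3)) s w.1 w.2.1 w.2.2) = 1 ↔
            (0 < dist (X u) (X w) ∧ dist (X u) (X w) < 6 / 5)) →
        ∀ u : ℤ × ℤ × ℤ, s (u.1 - 1) ≠ s u.1 →
          (starDefect a₀ h₀
              ((Measure.count : Measure (EuclideanSpace ℝ (Fin 3))).restrict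
                ((fun z : EuclideanSpace ℝ (Fin 3) => z - X u) '' Set.range X)) = 0 ∨
            (⨅ A : EuclideanSpace ℝ (Fin 3) ≃ₗᵢ[ℝ] EuclideanSpace ℝ (Fin 3),
              ∑ p ∈ fccKissingPattern, Metric.infDist (A (a₀ • p))
                (rootStar
                  ((Measure.count : Measure (EuclideanSpace ℝ (Fin 3))).restrict
                    ((fun z : EuclideanSpace ℝ (Fin 3) => z - X u) '' Set.range X))) ^ 2) = 0) →
          (Measure.count : Measure (EuclideanSpace ℝ (Fin 3))).restrict
              ((fun z : EuclideanSpace ℝ (Fin 3) => z - X u) '' Set.range X)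
              {y : EuclideanSpace ℝ (Fin 3) | 11 / 10 < ‖y‖ ∧ ‖y‖ ≤ 5 / 4} = 0 →
          ∃ A : EuclideanSpace ℝ (Fin 3) ≃ₗᵢ[ℝ] EuclideanSpace ℝ (Fin 3), ∀ w : ℤ × ℤ × ℤ,
            dist (barlowPos 1 (Real.sqrt (2 / 3)) s u.1 u.2.1 u.2.2) (barlowPos 1 (Real.sqrt (2 / 3)) s w.1 w.2.1 w.2.2) = 1 →
            X w - X u = A (barlowPos a₀ h₀ s w.1 w.2.1 w.2.2 - barlowPos a₀ h₀ s u.1 u.2.1 u.2.2))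
    (hC : ∀ a₀ h₀ : ℝ, 189 / 200 ≤ a₀ → a₀ ≤ 199 / 200 → 77 / 100 ≤ h₀ → h₀ ≤ 163 / 200 →
      ∀ s : ℤ → ℤ, IsHaggSeq s →
      ∀ X : ℤ × ℤ × ℤ → EuclideanSpace ℝ (Fin 3), Function.Injective X →
        (∀ u w : ℤ × ℤ × ℤ,
          dist (barlowPos 1 (Real.sqrt (2 / 3)) s u.1 u.2.1 u.2.2) (barlowPos 1 (Real.sqrt (2 / 3)) s w.1 w.2.1 w.2.2) = 1 ↔
            (0 < dist (X u) (X w) ∧ dist (X u) (X w) < 6 / 5)) →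
        ∀ u : ℤ × ℤ × ℤ, s (u.1 - 1) = s u.1 →
          (starDefect a₀ h₀
              ((Measure.count : Measure (EuclideanSpace ℝ (Fin 3))).restrict
                ((fun z : EuclideanSpace ℝ (Fin 3) => z - X u) '' Set.range X)) = 0 ∨
            (⨅ A : EuclideanSpace ℝ (Fin 3) ≃ₗᵢ[ℝ] EuclideanSpace ℝ (Fin 3),
              ∑ p ∈ fccKissingPattern, Metric.infDist (A (a₀ • p))
                (rootStar
                  ((Measure.count : Measure (EuclideanSpace ℝ (Fin 3))).restrict
                    ((fun z : EuclideanSpace ℝ (Fin 3) => z - X u) '' Set.range X))) ^ 2) = 0) →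
          (Measure.count : Measure (EuclideanSpace ℝ (Fin 3))).restrict
              ((fun z : EuclideanSpace ℝ (Fin 3) => z - X u) '' Set.range X)
              {y : EuclideanSpace ℝ (Fin 3) | 11 / 10 < ‖y‖ ∧ ‖y‖ ≤ 5 / 4} = 0 →
          ∃ A : EuclideanSpace ℝ (Fin 3) ≃ₗᵢ[ℝ] EuclideanSpace ℝ (Fin 3), ∀ w : ℤ × ℤ × ℤ,
            dist (barlowPos 1 (Real.sqrt (2 / 3)) s u.1 u.2.1 u.2.2) (barlowPos 1 (Real.sqrt (2 / 3)) s w.1 w.2.1 w.2.2) = 1 →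
            X w - X u = A (barlowPos a₀ (a₀ * Real.sqrt (2 / 3)) s w.1 w.2.1 w.2.2 -
              barlowPos a₀ (a₀ * Real.sqrt (2 / 3)) s u.1 u.2.1 u.2.2))
    (hP : ∀ a₀ h₀ : ℝ, 189 / 200 ≤ a₀ → a₀ ≤ 199 / 200 → 77 / 100 ≤ h₀ → h₀ ≤ 163 / 200 →
      ∀ s : ℤ → ℤ, IsHaggSeq s →
      ∀ X : ℤ × ℤ × ℤ → EuclideanSpace ℝ (Fin 3), X (0, 0, 0) = 0 →
        (∀ u : ℤ × ℤ × ℤ, s (u.1 - 1) ≠ s u.1 →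
          ∃ A : EuclideanSpace ℝ (Fin 3) ≃ₗᵢ[ℝ] EuclideanSpace ℝ (Fin 3), ∀ w : ℤ × ℤ × ℤ,
            dist (barlowPos 1 (Real.sqrt (2 / 3)) s u.1 u.2.1 u.2.2) (barlowPos 1 (Real.sqrt (2 / 3)) s w.1 w.2.1 w.2.2) = 1 →
            X w - X u = A (barlowPos a₀ h₀ s w.1 w.2.1 w.2.2 - barlowPos a₀ h₀ s u.1 u.2.1 u.2.2)) →
        (∀ u : ℤ × ℤ × ℤ, s (u.1 - 1) = s u.1 →
          ∃ A : EuclideanSpace ℝ (Fin 3) ≃ₗᵢ[ℝ] EuclideanSpace ℝ (Fin 3), ∀ w : ℤ × ℤ × ℤ,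
            dist (barlowPos 1 (Real.sqrt (2 / 3)) s u.1 u.2.1 u.2.2) (barlowPos 1 (Real.sqrt (2 / 3)) s w.1 w.2.1 w.2.2) = 1 →
            X w - X u = A (barlowPos a₀ (a₀ * Real.sqrt (2 / 3)) s w.1 w.2.1 w.2.2 -
              barlowPos a₀ (a₀ * Real.sqrt (2 / 3)) s u.1 u.2.1 u.2.2)) →
        ∃ h : ℝ, (h = h₀ ∨ h = a₀ * Real.sqrt (2 / 3)) ∧
          ∃ A : EuclideanSpace ℝ (Fin 3) ≃ₗᵢ[ℝ] EuclideanSpace ℝ (Fin 3), ∀ u : ℤ × ℤ × ℤ,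
            X u = A (barlowPos a₀ h s u.1 u.2.1 u.2.2)) :
    ∀ a₀ h₀ : ℝ, 189 / 200 ≤ a₀ → a₀ ≤ 199 / 200 → 77 / 100 ≤ h₀ → h₀ ≤ 163 / 200 →
      ∀ S : Set (EuclideanSpace ℝ (Fin 3)), (0 : EuclideanSpace ℝ (Fin 3)) ∈ S →
        (∀ y ∈ S, SetGood S y) →
        (∃ s : ℤ → ℤ, IsHaggSeq s ∧
          ∃ Φ : EuclideanSpace ℝ (Fin 3) → EuclideanSpace ℝ (Fin 3),
            Set.BijOn Φ (barlowStacking 1 (Real.sqrt (2 / 3)) s) S ∧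
            ∀ p ∈ barlowStacking 1 (Real.sqrt (2 / 3)) s, ∀ q ∈ barlowStacking 1 (Real.sqrt (2 / 3)) s,
              (dist p q = 1 ↔ (0 < dist (Φ p) (Φ q) ∧ dist (Φ p) (Φ q) < 6 / 5))) →
        (∀ x ∈ S,
          (starDefect a₀ h₀
              ((Measure.count : Measure (EuclideanSpace ℝ (Fin 3))).restrict ((fun z : EuclideanSpace ℝ (Fin 3) => z - x) '' S)) = 0 ∨
            (⨅ A : EuclideanSpace ℝ (Fin 3) ≃ₗᵢ[ℝ] EuclideanSpace ℝ (Fin 3),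
              ∑ p ∈ fccKissingPattern, Metric.infDist (A (a₀ • p))
                (rootStar ((Measure.count : Measure (EuclideanSpace ℝ (Fin 3))).restrict
                  ((fun z : EuclideanSpace ℝ (Fin 3) => z - x) '' S))) ^ 2) = 0) ∧
          (Measure.count : Measure (EuclideanSpace ℝ (Fin 3))).restrict ((fun z : EuclideanSpace ℝ (Fin 3) => z - x) '' S)
            {y : EuclideanSpace ℝ (Fin 3) | 11 / 10 < ‖y‖ ∧ ‖y‖ ≤ 5 / 4} = 0) →
        ∃ A : EuclideanSpace ℝ (Fin 3) ≃ₗᵢ[ℝ] EuclideanSpace ℝ (Fin 3), ∃ h : ℝ, (h = h₀ ∨ h = a₀ * Real.sqrt (2 / 3)) ∧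
          ∃ s' : ℤ → ℤ, IsHaggSeq s' ∧ S = A '' barlowStacking a₀ h s' := by
  intro a₀ h₀ ha₁ ha₂ hh₁ hh₂ S h0S _hgood hchart hx
  obtain ⟨s, hs, Φ, hΦ, hbond⟩ := hchart
  -- the label of the root
  obtain ⟨p₀, hp₀, hΦp₀⟩ := hΦ.surjOn h0S
  obtain ⟨k₀, i₀, j₀, rfl⟩ := hp₀
  -- the shifted word and the indexation `X`
  set r : ℝ := Real.sqrt (2 / 3) with hr
  set s' : ℤ → ℤ := fun m => s (m + k₀) with hs'_def
  have hs' : IsHaggSeq s' := fun i => hs (i + k₀)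
  set X : ℤ × ℤ × ℤ → (EuclideanSpace ℝ (Fin 3)) := fun u => Φ (barlowPos 1 r s (u.1 + k₀) (u.2.1 + i₀) (u.2.2 + j₀)) with hX_def
  have hsite : ∀ u : ℤ × ℤ × ℤ, barlowPos 1 r s (u.1 + k₀) (u.2.1 + i₀) (u.2.2 + j₀) =
      barlowPos 1 r s k₀ i₀ j₀ + barlowPos 1 r s' u.1 u.2.1 u.2.2 := fun u =>
    barlowPos_add_shift 1 r s k₀ i₀ j₀ u.1 u.2.1 u.2.2
  have hmem : ∀ u : ℤ × ℤ × ℤ, barlowPos 1 r s (u.1 + k₀) (u.2.1 + i₀) (u.2.2 + j₀) ∈ barlowStacking 1 r s :=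
    fun u => barlowPos_mem _ _ _
  have hmem' : ∀ u : ℤ × ℤ × ℤ, barlowPos 1 r s k₀ i₀ j₀ + barlowPos 1 r s' u.1 u.2.1 u.2.2 ∈ barlowStacking 1 r s :=
    fun u => hsite u ▸ hmem u
  have hXu : ∀ u : ℤ × ℤ × ℤ, X u = Φ (barlowPos 1 r s k₀ i₀ j₀ + barlowPos 1 r s' u.1 u.2.1 u.2.2) := fun u => by
    simp only [hX_def, hsite]
  have hX0 : X (0, 0, 0) = 0 := by
    simp only [hX_def, zero_add]
    exact hΦp₀
  -- `X` is injective
  have hXinj : Function.Injective X := by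
    intro u w huw
    have h1 := hΦ.injOn (hmem u) (hmem w) huw
    have hr0 : (0 : ℝ) < r := Real.sqrt_pos.2 (by norm_num)
    have h2 := Summit.AtomisticToContinuum.Crystallization.Theorems.barlowPos_injective one_pos hr0 s
      (a₁ := (u.1 + k₀, u.2.1 + i₀, u.2.2 + j₀)) (a₂ := (w.1 + k₀, w.2.1 + i₀, w.2.2 + j₀)) h1
    simp only [Prod.mk.injEq, add_left_inj] at h2
    exact Prod.ext h2.1 (Prod.ext h2.2.1 h2.2.2)
  -- `X` is onto `S`
  have hrange : Set.range X = S := by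
    apply Set.Subset.antisymm
    · rintro y ⟨u, rfl⟩
      exact hΦ.mapsTo (hmem u)
    · intro y hy
      obtain ⟨p, hp, rfl⟩ := hΦ.surjOn hy
      obtain ⟨k, i, j, rfl⟩ := hp
      refine ⟨(k - k₀, i - i₀, j - j₀), ?_⟩
      simp only [hX_def, sub_add_cancel]
  -- `X` is charted for the shifted word
  have hchartX : ∀ u w : ℤ × ℤ × ℤ,
      dist (barlowPos 1 r s' u.1 u.2.1 u.2.2) (barlowPos 1 r s' w.1 w.2.1 w.2.2) = 1 ↔
        (0 < dist (X u) (X w) ∧ dist (X u) (X w) < 6 / 5) := by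
    intro u w
    have h1 := hbond _ (hmem' u) _ (hmem' w)
    rw [dist_add_left] at h1
    rw [hXu u, hXu w]
    exact h1
  -- exact stars and empty annuli at every `X u`
  have hxX : ∀ u : ℤ × ℤ × ℤ,
      (starDefect a₀ h₀
          ((Measure.count : Measure (EuclideanSpace ℝ (Fin 3))).restrict ((fun z : (EuclideanSpace ℝ (Fin 3)) => z - X u) '' Set.range X)) = 0 ∨
        (⨅ A : (EuclideanSpace ℝ (Fin 3)) ≃ₗᵢ[ℝ] (EuclideanSpace ℝ (Fin 3)), ∑ p ∈ fccKissingPattern, Metric.infDist (A (a₀ • p))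
          (rootStar ((Measure.count : Measure (EuclideanSpace ℝ (Fin 3))).restrict ((fun z : (EuclideanSpace ℝ (Fin 3)) => z - X u) '' Set.range X))) ^ 2) = 0) ∧
      (Measure.count : Measure (EuclideanSpace ℝ (Fin 3))).restrict ((fun z : (EuclideanSpace ℝ (Fin 3)) => z - X u) '' Set.range X)
        {y : (EuclideanSpace ℝ (Fin 3)) | 11 / 10 < ‖y‖ ∧ ‖y‖ ≤ 5 / 4} = 0 := by
    intro u
    rw [hrange]
    exact hx (X u) (hrange ▸ Set.mem_range_self u)
  -- local frames (X2a at `h`-type sites, X2b at `c`-type sites)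
  have hframeH : ∀ u : ℤ × ℤ × ℤ, s' (u.1 - 1) ≠ s' u.1 →
      ∃ A : (EuclideanSpace ℝ (Fin 3)) ≃ₗᵢ[ℝ] (EuclideanSpace ℝ (Fin 3)), ∀ w : ℤ × ℤ × ℤ,
        dist (barlowPos 1 r s' u.1 u.2.1 u.2.2) (barlowPos 1 r s' w.1 w.2.1 w.2.2) = 1 →
        X w - X u = A (barlowPos a₀ h₀ s' w.1 w.2.1 w.2.2 - barlowPos a₀ h₀ s' u.1 u.2.1 u.2.2) :=
    fun u hu => hH a₀ h₀ ha₁ ha₂ hh₁ hh₂ s' hs' X hXinj hchartX u hu (hxX u).1 (hxX u).2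
  have hframeC : ∀ u : ℤ × ℤ × ℤ, s' (u.1 - 1) = s' u.1 →
      ∃ A : (EuclideanSpace ℝ (Fin 3)) ≃ₗᵢ[ℝ] (EuclideanSpace ℝ (Fin 3)), ∀ w : ℤ × ℤ × ℤ,
        dist (barlowPos 1 r s' u.1 u.2.1 u.2.2) (barlowPos 1 r s' w.1 w.2.1 w.2.2) = 1 →
        X w - X u = A (barlowPos a₀ (a₀ * Real.sqrt (2 / 3)) s' w.1 w.2.1 w.2.2 -
          barlowPos a₀ (a₀ * Real.sqrt (2 / 3)) s' u.1 u.2.1 u.2.2) :=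
    fun u hu => hC a₀ h₀ ha₁ ha₂ hh₁ hh₂ s' hs' X hXinj hchartX u hu (hxX u).1 (hxX u).2
  -- propagation (X2c)
  obtain ⟨h, hh, A, hA⟩ := hP a₀ h₀ ha₁ ha₂ hh₁ hh₂ s' hs' X hX0 hframeH hframeC
  refine ⟨A, h, hh, s', hs', ?_⟩
  rw [← hrange]
  ext y
  simp only [Set.mem_range, Set.mem_image, mem_barlowStacking_iff]
  constructor
  · rintro ⟨u, rfl⟩
    exact ⟨barlowPos a₀ h s' u.1 u.2.1 u.2.2, ⟨u.1, u.2.1, u.2.2, rfl⟩, (hA u).symm⟩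
  · rintro ⟨p, ⟨k, i, j, rfl⟩, rfl⟩
    exact ⟨(k, i, j), hA (k, i, j)⟩

/-- **X2 `stub_exactStarRigidity` (registered by the strategist gen 2; PROVED — glue over the landed X2a + X2b + X2c, lead c9).**
EXACT STARS EVERYWHERE ⇒ AN EXACT STACKING: an everywhere-`SetGood` Barlow-charted set containing `0` all of whose re-rooted stars are
exact (relaxed-hcp OR fcc type, annuli `(11/10, 5/4]` empty) is `A '' barlowStacking a₀ h s'` with `h ∈ {h₀, a₀√(2/3)}`. [folklore] -/
theorem stub_exactStarRigidity :
    ∀ a₀ h₀ : ℝ, 189 / 200 ≤ a₀ → a₀ ≤ 199 / 200 → 77 / 100 ≤ h₀ → h₀ ≤ 163 / 200 →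
      ∀ S : Set (EuclideanSpace ℝ (Fin 3)), (0 : EuclideanSpace ℝ (Fin 3)) ∈ S →
        (∀ y ∈ S, SetGood S y) →
        (∃ s : ℤ → ℤ, IsHaggSeq s ∧
          ∃ Φ : EuclideanSpace ℝ (Fin 3) → EuclideanSpace ℝ (Fin 3),
            Set.BijOn Φ (barlowStacking 1 (Real.sqrt (2 / 3)) s) S ∧
            ∀ p ∈ barlowStacking 1 (Real.sqrt (2 / 3)) s, ∀ q ∈ barlowStacking 1 (Real.sqrt (2 / 3)) s,
              (dist p q = 1 ↔ (0 < dist (Φ p) (Φ q) ∧ dist (Φ p) (Φ q) < 6 / 5))) →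
        (∀ x ∈ S,
          (Summit.AtomisticToContinuum.Crystallization.Theorems.PalmUnimodularRigidity.LayeredLawsSelectHcp.starDefect a₀ h₀
              ((Measure.count : Measure (EuclideanSpace ℝ (Fin 3))).restrict ((fun z : EuclideanSpace ℝ (Fin 3) => z - x) '' S)) = 0 ∨
            (⨅ A : EuclideanSpace ℝ (Fin 3) ≃ₗᵢ[ℝ] EuclideanSpace ℝ (Fin 3),
              ∑ p ∈ fccKissingPattern, Metric.infDist (A (a₀ • p))
                (Summit.AtomisticToContinuum.Crystallization.Theorems.PalmUnimodularRigidity.LayeredLawsSelectHcp.rootStar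
                  ((Measure.count : Measure (EuclideanSpace ℝ (Fin 3))).restrict ((fun z : EuclideanSpace ℝ (Fin 3) => z - x) '' S))) ^ 2) = 0) ∧
          (Measure.count : Measure (EuclideanSpace ℝ (Fin 3))).restrict ((fun z : EuclideanSpace ℝ (Fin 3) => z - x) '' S)
            {y : EuclideanSpace ℝ (Fin 3) | 11 / 10 < ‖y‖ ∧ ‖y‖ ≤ 5 / 4} = 0) →
        ∃ A : EuclideanSpace ℝ (Fin 3) ≃ₗᵢ[ℝ] EuclideanSpace ℝ (Fin 3), ∃ h : ℝ, (h = h₀ ∨ h = a₀ * Real.sqrt (2 / 3)) ∧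
          ∃ s' : ℤ → ℤ, IsHaggSeq s' ∧ S = A '' barlowStacking a₀ h s' :=
  exactStarRigidity_of_frames ExactFrameH.stub_exactFrameH ExactFrameC.stub_exactFrameC FramePropagation.stub_framePropagation

end ExactStarGlue

end Summit.AtomisticToContinuum.Crystallization.Theorems.PalmGoodLaw.ExactStarShortcutRigidity

end
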